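import Literature.NumberTheory.Transcendental.KZLogCalculusProofs
import Literature.NumberTheory.Transcendental.KZIntervalPeriodProofs

/-!
# `BetaCancellation` (stmt-KontsevichZagierPeriods-13633), line `dirichlet-companion-to-pi`: stub `stub_weightExists`

For a bounded `ℚ`-semialgebraic weight `w : ℝ → ℝ` of one real variable and an integral
representation `r = [t, f]` of dimension `k + 1 ≥ 1`, the weighted companion `[t, w (z 0) · f]` is
again an integral representation: the integrand `z ↦ w (z 0)` is `ℚ`-semialgebraic on `ℝ^{k+1}`
(coordinate preimage of the graph of `w`, no Tarski–Seidenberg needed), the product of two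
semialgebraic functions is semialgebraic, and a bounded measurable function times an integrable one
is integrable (`MeasureTheory.Integrable.bdd_mul`). This is the input of the multiplier operator
`M_w [t, f] = [t, w (z 0) · f]` of the weight-descent line.
-/

noncomputable section

set_option linter.dupNamespace false

namespace Summit.KontsevichZagierPeriods.KontsevichZagierPeriods.BetaCancellationLine

open Set
open MeasureTheory
open Literature.NumberTheory.Transcendental
open Literature.NumberTheory.Transcendental.KZ

-- adapted from Summits/KontsevichZagierPeriods/KontsevichZagierPeriods/Cruxes/LogKernelConjecture/DrefuteEngineG2.lean
-- (`isSemialgebraicFunOn_coord`, `measurable_weight`, `reweight`)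

/-- If `t ↦ w (t 0)` is `ℚ`-semialgebraic on `ℝ¹`, then `x ↦ w (x i)` is `ℚ`-semialgebraic on all of
`ℝⁿ`: its graph is the preimage of the graph of `w` under the coordinate map
`z ↦ (z (castSucc i), z last)`. [folklore] -/
theorem weightExists_isSemialgebraicFunOn_coord {w : ℝ → ℝ}
    (hw : IsSemialgebraicFunOn ℚ (Set.univ : Set (Fin 1 → ℝ)) (fun x => w (x 0)))
    {n : ℕ} (i : Fin n) :
    IsSemialgebraicFunOn ℚ (Set.univ : Set (Fin n → ℝ)) (fun x => w (x i)) := by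
  rw [isSemialgebraicFunOn_iff] at hw ⊢
  convert hw.preimage_comp ![Fin.castSucc i, Fin.last n] using 1
  ext z
  simp only [mem_univ, true_and, mem_setOf_eq, mem_preimage]
  have h1 : (z ∘ ![Fin.castSucc i, Fin.last n]) (Fin.last 1) = z (Fin.last n) := by
    simp
  have h2 : Fin.init (z ∘ ![Fin.castSucc i, Fin.last n]) 0 = z (Fin.castSucc i) := by
    simp [Fin.init]
  rw [h1, h2]
  rfl

/-- If `t ↦ w (t 0)` is `ℚ`-semialgebraic on `ℝ¹`, then `w` is Borel measurable (semialgebraic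
functions are measurable, and `ℝ → ℝ¹`, `x ↦ (x)` is measurable). [folklore] -/
theorem weightExists_measurable {w : ℝ → ℝ}
    (hw : IsSemialgebraicFunOn ℚ (Set.univ : Set (Fin 1 → ℝ)) (fun x => w (x 0))) :
    Measurable w := by
  have h := IsSemialgebraicFunOn.measurable_holds hw
  have h2 : Measurable (fun t : Fin 1 → ℝ => w (t 0)) :=
    h.comp (Measurable.subtype_mk (p := fun x => x ∈ (univ : Set (Fin 1 → ℝ)))
      (h := fun _ => mem_univ _) measurable_id)
  exact h2.comp (measurable_pi_lambda (fun x : ℝ => fun _ : Fin 1 => x) fun _ => measurable_id)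

/-- **Weighted representations exist**: for a bounded `ℚ`-semialgebraic weight `w` of one real
variable, every representation `[t, f]` of dimension `≥ 1` has the companion `[t, w (z 0) · f]`
(semialgebraic as a product of semialgebraic functions, integrable as bounded measurable ×
integrable). [folklore] -/
theorem stub_weightExists :
    ∀ (w : ℝ → ℝ), IsSemialgebraicFunOn ℚ (Set.univ : Set (Fin 1 → ℝ)) (fun x => w (x 0)) →
    ∀ (B : ℝ), (∀ t : ℝ, |w t| ≤ B) →
    ∀ (k : ℕ) (r : IntegralRep (k + 1)),
      ∃ s : IntegralRep (k + 1), s.domain = r.domain ∧ s.integrand = fun z => w (z 0) * r.integrand z := by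
  intro w hw B hB k r
  have hsa : IsSemialgebraicFunOn ℚ r.domain (fun z : Fin (k + 1) → ℝ => w (z 0) * r.integrand z) :=
    IsSemialgebraicFunOn.mul_holds
      ((weightExists_isSemialgebraicFunOn_coord hw (0 : Fin (k + 1))).mono (subset_univ _)
        r.isSemialgebraic_domain)
      r.isSemialgebraicFunOn_integrand
  have hmeas : AEStronglyMeasurable (fun z : Fin (k + 1) → ℝ => w (z 0))
      (volume.restrict r.domain) :=
    ((weightExists_measurable hw).comp (measurable_pi_apply _)).aestronglyMeasurable
  have hint : IntegrableOn (fun z : Fin (k + 1) → ℝ => w (z 0) * r.integrand z) r.domain :=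
    r.integrableOn.bdd_mul hmeas (c := B) (Filter.Eventually.of_forall fun z => by
      rw [Real.norm_eq_abs]
      exact hB _)
  exact ⟨⟨r.domain, fun z => w (z 0) * r.integrand z, r.isSemialgebraic_domain, hsa, hint⟩,
    rfl, rfl⟩

end Summit.KontsevichZagierPeriods.KontsevichZagierPeriods.BetaCancellationLine

end
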